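import Literature.NumberTheory.DiophantineGeometry.SchurWeylPlethysm
import HarnessLib

/-!
# Transport of orbit closures along renaming of variables: discharges

Sibling proofs file of `Literature/NumberTheory/DiophantineGeometry/SchurWeylPlethysm.lean`
(next to `SchurWeylPlethysmProofs.lean`, `SchurWeylPlethysmPolynomialProofs.lean`,
`SchurWeylPlethysmHwMultiplicityProofs.lean`).
It discharges two named facts of that file:

* `Literature.NumberTheory.DiophantineGeometry.rename_mem_orbitClosure_rename_iff`: for an equivalence of variable types
  `e : σ ≃ τ`, `rename e g ∈ Δ[rename e f] ↔ g ∈ Δ[f]`. Renaming conjugates the substitution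
  action (`rename e (A · f) = (reindex e e A) · rename e f`, so `rename e '' (GL · f) ⊆
  GL · rename e f`), and a test polynomial `p` on the coefficient space of `τ`-polynomials pulls
  back to the test polynomial `rename ψ p`, `ψ d' = equivMapDomain e.symm d'`, on the coefficient
  space of `σ`-polynomials with `p(rename e h) = (rename ψ p)(h)`; this gives `⇐`, and `⇒` is `⇐`
  for `e.symm`.
* `Literature.NumberTheory.DiophantineGeometry.hasBorderDetRepr_iff_rename`: G20's `HasBorderDetRepr k n m` (variables
  `Fin m × Fin m`) is the same statement in the lexicographic variables `MatIdx m` (the preserved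
  interim proof: the previous fact with `e = toLex`).

## Sources

* K. Mulmuley, M. Sohoni, *Geometric complexity theory I*, SIAM J. Comput. 31 (2001), §4
  (orbit closures; Conj. 4.3) (key `MulmuleySohoni2001`).
-/

noncomputable section

open MvPolynomial

namespace Literature.NumberTheory.DiophantineGeometry

variable {k : Type*} [Field k] {σ τ : Type*}

/-- Coefficients of a renamed polynomial along an equivalence:
`coeff d' (rename e h) = coeff (equivMapDomain e.symm d') h`. [folklore] -/
theorem coeff_rename_equiv (e : σ ≃ τ) (h : MvPolynomial σ k) (d' : τ →₀ ℕ) :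
    coeff d' (rename e h) = coeff (Finsupp.equivMapDomain e.symm d') h := by
  conv_lhs => rw [show d' = (Finsupp.equivMapDomain e.symm d').mapDomain e by
    rw [← Finsupp.equivMapDomain_eq_mapDomain, ← Finsupp.equivMapDomain_trans,
      Equiv.symm_trans_self, Finsupp.equivMapDomain_refl]]
  exact coeff_rename_mapDomain e e.injective h _

/-- Pull-back of test polynomials along renaming: `p(rename e h) = (rename ψ p)(h)` with
`ψ d' = equivMapDomain e.symm d'` on monomials. Mulmuley–Sohoni 2001 §4. [cite: MulmuleySohoni2001, §4] -/
theorem aeval_coeffVec_rename (e : σ ≃ τ) (h : MvPolynomial σ k)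
    (p : MvPolynomial (τ →₀ ℕ) k) :
    aeval (Literature.Computability.AlgebraicComplexity.coeffVec (rename e h)) p =
      aeval (Literature.Computability.AlgebraicComplexity.coeffVec h) (rename (fun d' : τ →₀ ℕ => Finsupp.equivMapDomain e.symm d') p) := by
  rw [aeval_rename]
  have hfun : Literature.Computability.AlgebraicComplexity.coeffVec (rename e h) =
      Literature.Computability.AlgebraicComplexity.coeffVec h ∘ fun d' : τ →₀ ℕ => Finsupp.equivMapDomain e.symm d' := by
    funext d'
    simp only [Function.comp_apply, Literature.Computability.AlgebraicComplexity.coeffVec_apply]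
    exact coeff_rename_equiv e h d'
  rw [hfun]

variable [Fintype σ] [Fintype τ]

/-- Renaming conjugates linear substitutions: `rename e (A · f) = (reindex e e A) · (rename e f)`.
Mulmuley–Sohoni 2001 §4. [cite: MulmuleySohoni2001, §4] -/
theorem rename_linSubst (e : σ ≃ τ) (A : Matrix σ σ k) (f : MvPolynomial σ k) :
    rename e (Literature.Computability.AlgebraicComplexity.linSubst σ k A f) = Literature.Computability.AlgebraicComplexity.linSubst τ k (Matrix.reindex e e A) (rename e f) := by
  suffices H : (rename e).comp (Literature.Computability.AlgebraicComplexity.linSubst σ k A) =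
      (Literature.Computability.AlgebraicComplexity.linSubst τ k (Matrix.reindex e e A)).comp (rename e) from
    congrArg (fun φ => φ f) H
  apply MvPolynomial.algHom_ext
  intro i
  simp only [AlgHom.comp_apply, rename_X, Literature.Computability.AlgebraicComplexity.linSubst_X, map_sum, map_smul]
  rw [← e.sum_comp]
  simp [Matrix.reindex_apply, Matrix.submatrix_apply]

variable [DecidableEq σ] [DecidableEq τ]

/-- Renaming maps orbits into orbits: `rename e '' (GL · f) ⊆ GL · (rename e f)`.
Mulmuley–Sohoni 2001 §4. [cite: MulmuleySohoni2001, §4] -/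
theorem rename_mem_glOrbit_rename (e : σ ≃ τ) {f h : MvPolynomial σ k}
    (hh : h ∈ Literature.Computability.AlgebraicComplexity.glOrbit σ k f) : rename e h ∈ Literature.Computability.AlgebraicComplexity.glOrbit τ k (rename e f) := by
  obtain ⟨g, rfl⟩ := hh
  refine ⟨Units.map (Matrix.reindexRingEquiv k e).toRingHom.toMonoidHom g, ?_⟩
  dsimp only
  rw [Literature.Computability.AlgebraicComplexity.linSubstRep_apply, Literature.Computability.AlgebraicComplexity.linSubstRep_apply, rename_linSubst]
  rfl

/-- One direction of the transport: `g ∈ Δ[f] ⇒ rename e g ∈ Δ[rename e f]`.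
Mulmuley–Sohoni 2001 §4. [cite: MulmuleySohoni2001, §4] -/
theorem rename_mem_orbitClosure_rename (e : σ ≃ τ) {f g : MvPolynomial σ k}
    (hg : g ∈ Literature.Computability.AlgebraicComplexity.orbitClosure f) : rename e g ∈ Literature.Computability.AlgebraicComplexity.orbitClosure (rename e f) := by
  rw [Literature.Computability.AlgebraicComplexity.mem_orbitClosure_iff] at hg ⊢
  intro p hp
  rw [aeval_coeffVec_rename]
  apply hg
  intro h hh
  rw [← aeval_coeffVec_rename]
  exact hp _ (rename_mem_glOrbit_rename e hh)

/-- **Discharge of `rename_mem_orbitClosure_rename_iff`**: `rename e g ∈ Δ[rename e f] ↔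
g ∈ Δ[f]` for an equivalence `e` of variable types (`⇒` is `⇐` for `e.symm`).
Mulmuley–Sohoni 2001 §4. [cite: MulmuleySohoni2001, §4] -/
theorem rename_mem_orbitClosure_rename_iff_holds :
    rename_mem_orbitClosure_rename_iff (k := k) := by
  intro σ τ _ _ _ _ e f g
  refine ⟨fun h => ?_, rename_mem_orbitClosure_rename e⟩
  have h' := rename_mem_orbitClosure_rename e.symm h
  simpa only [rename_rename, Equiv.symm_comp_self, rename_id, AlgHom.id_apply] using h'

/-- **Discharge of `hasBorderDetRepr_iff_rename`**: `HasBorderDetRepr k n m ↔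
paddedPerFormLex k n m ∈ Δ[detFormLex k m]` (the fact `rename_mem_orbitClosure_rename_iff` with
`e = toLex`; this is the preserved interim proof). Mulmuley–Sohoni 2001 §4 (Conj. 4.3).
[cite: MulmuleySohoni2001, §4] -/
theorem hasBorderDetRepr_iff_rename_holds : hasBorderDetRepr_iff_rename (k := k) := by
  intro n m _
  exact (rename_mem_orbitClosure_rename_iff_holds toLex (Literature.Computability.AlgebraicComplexity.detPoly (Fin m) k)
    (Literature.Computability.AlgebraicComplexity.paddedPerPoly k n m)).symm

end Literature.NumberTheory.DiophantineGeometry
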